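import Literature.NumberTheory.LFunctions.Polymath15Combination
import Literature.NumberTheory.LFunctions.RiemannSiegelLehmerBounds
import Literature.NumberTheory.LFunctions.DeBruijnNewmanBoundOfCertificates
import Literature.NumberTheory.LFunctions.Polymath15MollifiedCriterion
import HarnessLib

/-!
# Polymath 15, Thm. 1.3 — discharge of `Polymath15.effective_approximation`

Topic `Literature/NumberTheory/LFunctions`; companion of `Polymath15EffectiveApproximation.lean` (which states
the named fact `Literature.NumberTheory.LFunctions.Polymath15.effective_approximation`, Polymath 15, Thm. 1.3:
`‖H_t(x+iy)/B_t(x+iy) − f_t(x+iy)‖ ≤ errAB + errC0` in the region (1.6)) holding its discharge, which cannot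
live in that file (the proof imports it). No definitions.

The proof is the tree's: `Polymath15.effective_approximation_of_arias : arias_lehmer_rs_bound → effective_approximation`
(`Polymath15Combination.lean`: §4 and §6 of the source — heat-flowed Riemann–Siegel expansion, Props. 6.1,
6.3 (corrected constants), 6.6) applied to `arias_lehmer_rs_bound_holds` (`RiemannSiegelLehmerBounds.lean`:
Arias de Reyna 2011, Thms. 3.1/4.1/4.2 and `|C₀| ≤ ½`, the source's Prop. 6.2, formalized in the
`AriasDeReyna*` files).

## The discharge fed to the in-tree users of Thm. 1.3

Every tree theorem that took Thm. 1.3 as the explicit hypothesis `(h : effective_approximation)` is restated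
below WITHOUT that hypothesis, by applying the original to `effective_approximation_holds` (statements otherwise
token-identical; names = the original name primed):

* `deBruijnH_ne_zero_of_err_lt'` — Cor. 1.4 (criterion for non-vanishing), now unconditional;
  `finalZeroFree_of_err_lt'`, `table1_row2_of_err_lt'` (`Polymath15EffectiveApproximation.lean`).
* `box_zero_free_of_windingCert'` — §8.4, the barrier box from a winding certificate for `f_t`;
  `table1_row2_barrier_box_of_windingCert'`, `table1_row2_of_windingCert'` (`Polymath15BarrierCert.lean`).
* `halfStrip_zero_free_of_mollified'`, `finalZeroFree_of_mollified'` — §8.5, the final-time half-strip from a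
  mollified argument principle (`Polymath15MollifiedCriterion.lean`).
* `upper_bound_of_certificates'`, `deBruijnNewmanConst_le_of_certificates'`,
  `deBruijnNewmanConst_le_of_certificates_platt_trudgian'`, `deBruijnNewmanConst_le_one_fifth_of_row2_certificates'`
  — `Λ ≤ t₀ + y₀²/2` (resp. `Λ ≤ 1/5`) from a verified RH height, a winding certificate and a tail inequality
  (`DeBruijnNewmanBoundOfCertificates.lean`).

So the Polymath 15 / Platt–Trudgian bounds `Λ ≤ t₀ + y₀²/2` in the tree are now conditional ONLY on their
computational inputs (the RH height — e.g. the named computational fact `platt_trudgian_numerical_rh` — and the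
two certificates), no longer on an unformalised analytic theorem. Nothing here changes any numerical value.

## References

* D. H. J. Polymath, *Effective approximation of heat flow evolution of the Riemann ξ function, and a new upper
  bound for the de Bruijn–Newman constant*, Res. Math. Sci. 6 (2019), Paper 31: Thm. 1.3, Cor. 1.4, §6, §8.2–8.5,
  §10 (Table 1, row 2). [Polymath2019]
* J. Arias de Reyna, *High precision computation of Riemann's zeta function by the Riemann–Siegel formula, I*,
  Math. Comp. 80 (2011), 995–1009. [AriasDeReyna2011]
* D. J. Platt, T. S. Trudgian, *The Riemann hypothesis is true up to `3·10¹²`*, Bull. Lond. Math. Soc. 53 (2021)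
  792–797: Thm. 1, §3.4, Cor. 2. [PlattTrudgianBLMS2021]
-/

noncomputable section

open Complex Set

namespace Literature.NumberTheory.LFunctions

namespace Polymath15

/-- **Polymath 15, Thm. 1.3 (effective Riemann–Siegel approximation of `H_t`) — proved**: for `t, x, y` in the
region (1.6), `‖H_t(x+iy)/B_t(x+iy) − f_t(x+iy)‖ ≤ errAB t x y + errC0 t x y`.
[cite: Polymath2019, Thm. 1.3 and §6 (Props. 6.1–6.3, 6.6)] [cite: AriasDeReyna2011, Thms. 3.1, 4.1, 4.2, 6.1] -/
theorem effective_approximation_holds : effective_approximation :=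
  effective_approximation_of_arias arias_lehmer_rs_bound_holds

/-! ## Cor. 1.4 and the (ii)-region, unconditional -/

/-- **Polymath 15, Cor. 1.4** ("criterion for non-vanishing"), unconditional: in the region (1.6), if
`errAB + errC0 < |f_t(x + iy)|` then `H_t(x + iy) ≠ 0`. (= `deBruijnH_ne_zero_of_err_lt` fed with
`effective_approximation_holds`.) [cite: Polymath2019, Cor. 1.4] -/
theorem deBruijnH_ne_zero_of_err_lt' {t x y : ℝ} (hr : EffRegion t x y)
    (hlt : errAB t x y + errC0 t x y < ‖ft t x y‖) : deBruijnH t (x + y * I) ≠ 0 :=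
  deBruijnH_ne_zero_of_err_lt effective_approximation_holds hr hlt

/-- Hypothesis (ii) of Thm. 1.2 (`FinalZeroFree t₀ X y₀`) from the pointwise criterion Cor. 1.4 at time
`t₀` on `x ≥ X + √(1 − y₀²)`, `y₀ ≤ y ≤ √(1 − 2t₀)` (`0 < t₀ ≤ 1/2`, `y₀ ≥ 0`, `X ≥ 200`), unconditional.
(= `finalZeroFree_of_err_lt` fed with `effective_approximation_holds`.) [cite: Polymath2019, §8.2–8.3] -/
theorem finalZeroFree_of_err_lt' {t₀ X y₀ : ℝ} (ht₀ : 0 < t₀) (ht : t₀ ≤ 1 / 2) (hy₀ : 0 ≤ y₀)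
    (hX : 200 ≤ X)
    (hpt : ∀ x y : ℝ, X + Real.sqrt (1 - y₀ ^ 2) ≤ x → y₀ ≤ y → y ≤ Real.sqrt (1 - 2 * t₀) →
      errAB t₀ x y + errC0 t₀ x y < ‖ft t₀ x y‖) :
    FinalZeroFree t₀ X y₀ :=
  finalZeroFree_of_err_lt effective_approximation_holds ht₀ ht hy₀ hX hpt

/-- Table 1, row 2 (`table1_row2`) from a pointwise lower bound for `|f_{0.186}|` beating the printed error
majorant on the (ii)-region of row 2 and the row-2 barrier box, unconditional in Thm. 1.3.
(= `table1_row2_of_err_lt` fed with `effective_approximation_holds`.)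
[cite: Polymath2019, §8.2–8.3 and §10, Table 1 (row 2)] -/
theorem table1_row2_of_err_lt'
    (hpt : ∀ x y : ℝ, 5 * 10 ^ 12 + 194858 + Real.sqrt (1 - 0.16733 ^ 2) ≤ x → 0.16733 ≤ y →
      y ≤ Real.sqrt (1 - 2 * 0.186) → errAB 0.186 x y + errC0 0.186 x y < ‖ft 0.186 x y‖)
    (hbox : table1_row2_barrier_box) : table1_row2 :=
  table1_row2_of_err_lt effective_approximation_holds hpt hbox

/-! ## §8.4: the barrier box from a winding certificate, unconditional -/

/-- **The barrier box from a winding certificate (Polymath 15, §8.2 (a) and §8.4, general parameters),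
unconditional in Thm. 1.3.** Let `0 < t₀ ≤ 1/2`, `0 ≤ y₀ < 1`, `X ≥ 200`; on the box `0 ≤ t ≤ t₀`,
`X ≤ x ≤ X + 1`, `y₀ ≤ y ≤ 1` assume (1) `N = ⌊√(x/4π + t/16)⌋` constant in `t`, (2) `errAB + errC0 ≤ μ`
for `t > 0`, (3) for every `t ∈ [0, t₀]` a winding certificate with margin `μ` for `z ↦ f_t(z)` on
`[X, X+1] × [y₀, 1]` (`WindingCertGt`). Then `H_t(x + iy) ≠ 0` on the closed box.
(= `box_zero_free_of_windingCert` fed with `effective_approximation_holds`.) [cite: Polymath2019, §8.4] -/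
theorem box_zero_free_of_windingCert' {t₀ X y₀ μ : ℝ}
    (ht₀ : 0 < t₀) (ht₀' : t₀ ≤ 1 / 2) (hy₀ : 0 ≤ y₀) (hy₀' : y₀ < 1) (hX : 200 ≤ X)
    (hN : ∀ t ∈ Icc 0 t₀, ∀ x ∈ Icc X (X + 1), rsN t x = rsN 0 x)
    (herr : ∀ t ∈ Ioc 0 t₀, ∀ x ∈ Icc X (X + 1), ∀ y ∈ Icc y₀ 1, errAB t x y + errC0 t x y ≤ μ)
    (hcert : ∀ t ∈ Icc 0 t₀, WindingCertGt (fz t) μ X (X + 1) y₀ 1) :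
    ∀ t x y : ℝ, 0 ≤ t → t ≤ t₀ → X ≤ x → x ≤ X + 1 → y₀ ≤ y → y ≤ 1 →
      deBruijnH t (x + y * I) ≠ 0 :=
  box_zero_free_of_windingCert effective_approximation_holds ht₀ ht₀' hy₀ hy₀' hX hN herr hcert

/-- **Polymath 15, Table 1, row 2 (barrier half) from a winding certificate for `f_t`**, unconditional in
Thm. 1.3: winding certificates with margin `1/500` on `[5·10¹² + 194858, 5·10¹² + 194859] × [0.16733, 1]`
for every `t ∈ [0, 0.186]` give `table1_row2_barrier_box`.
(= `table1_row2_barrier_box_of_windingCert` fed with `effective_approximation_holds`.)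
[cite: Polymath2019, §10, Table 1 (row 2)] -/
theorem table1_row2_barrier_box_of_windingCert'
    (hcert : ∀ t ∈ Icc (0 : ℝ) 0.186, WindingCertGt (fz t) (1 / 500)
      (5 * 10 ^ 12 + 194858) (5 * 10 ^ 12 + 194858 + 1) 0.16733 1) :
    table1_row2_barrier_box :=
  table1_row2_barrier_box_of_windingCert effective_approximation_holds hcert

/-- Table 1, row 2 (`table1_row2`) from the hypothesis `FinalZeroFree 0.186 X 0.16733` and a winding
certificate for the barrier, unconditional in Thm. 1.3.
(= `table1_row2_of_windingCert` fed with `effective_approximation_holds`.)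
[cite: Polymath2019, §10, Table 1 (row 2)] -/
theorem table1_row2_of_windingCert'
    (hii : FinalZeroFree 0.186 (5 * 10 ^ 12 + 194858) 0.16733)
    (hcert : ∀ t ∈ Icc (0 : ℝ) 0.186, WindingCertGt (fz t) (1 / 500)
      (5 * 10 ^ 12 + 194858) (5 * 10 ^ 12 + 194858 + 1) 0.16733 1) :
    table1_row2 :=
  table1_row2_of_windingCert effective_approximation_holds hii hcert

/-! ## §8.5: the final-time half-strip from a mollified argument principle, unconditional -/

/-- **Polymath 15, §8.5 (claims (b), (c)), general parameters and general mollifier, unconditional in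
Thm. 1.3**: under the edge hypotheses (L), (T), (R), (B) of `halfStrip_zero_free_of_mollified` for an
analytic mollifier `E` with `Re E > 0`, `|E| ≤ E_max` on the half-strip, `H_{t₀}(x + iy) ≠ 0` for all
`x ≥ X`, `y₀ ≤ y ≤ 1`. (= `halfStrip_zero_free_of_mollified` fed with `effective_approximation_holds`.)
[cite: Polymath2019, §8.5] -/
theorem halfStrip_zero_free_of_mollified' {t₀ X X₁ y₀ Emax : ℝ}
    {E : ℂ → ℂ} (ht₀ : 0 < t₀) (ht₀' : t₀ ≤ 1 / 2) (hy₀ : 0 < y₀) (hy₀' : y₀ < 1) (hX : 200 ≤ X)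
    (hE : AnalyticOnNhd ℂ E certDomain)
    (hEre : ∀ x y : ℝ, X ≤ x → y₀ ≤ y → y ≤ 1 → 0 < (E (x + y * I)).re)
    (hEmax : ∀ x y : ℝ, X ≤ x → y₀ ≤ y → y ≤ 1 → ‖E (x + y * I)‖ ≤ Emax)
    (hleft : ∀ y : ℝ, y₀ ≤ y → y ≤ 1 → errAB t₀ X y + errC0 t₀ X y < (ft t₀ X y).re)
    (htop : ∀ x : ℝ, X ≤ x → errAB t₀ x 1 + errC0 t₀ x 1 < (ft t₀ x 1).re)
    (hright : ∀ x y : ℝ, X₁ ≤ x → y₀ ≤ y → y ≤ 1 →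
      errAB t₀ x y + errC0 t₀ x y < (ft t₀ x y).re)
    (hbot : ∀ x : ℝ, X ≤ x → x ≤ X₁ → ∀ w : ℂ,
      ‖w - E (x + y₀ * I) * ft t₀ x y₀‖ ≤ Emax * (errAB t₀ x y₀ + errC0 t₀ x y₀) → w ∈ slitPlane) :
    ∀ x y : ℝ, X ≤ x → y₀ ≤ y → y ≤ 1 → deBruijnH t₀ (x + y * I) ≠ 0 :=
  halfStrip_zero_free_of_mollified effective_approximation_holds ht₀ ht₀' hy₀ hy₀' hX hE hEre hEmax
    hleft htop hright hbot

/-- The same packaged as hypothesis (ii) of Thm. 1.2 (`FinalZeroFree t₀ X y₀`), unconditional in Thm. 1.3.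
(= `finalZeroFree_of_mollified` fed with `effective_approximation_holds`.)
[cite: Polymath2019, §8.2 and §8.5] -/
theorem finalZeroFree_of_mollified' {t₀ X X₁ y₀ Emax : ℝ}
    {E : ℂ → ℂ} (ht₀ : 0 < t₀) (ht₀' : t₀ ≤ 1 / 2) (hy₀ : 0 < y₀) (hy₀' : y₀ < 1) (hX : 200 ≤ X)
    (hE : AnalyticOnNhd ℂ E certDomain)
    (hEre : ∀ x y : ℝ, X ≤ x → y₀ ≤ y → y ≤ 1 → 0 < (E (x + y * I)).re)
    (hEmax : ∀ x y : ℝ, X ≤ x → y₀ ≤ y → y ≤ 1 → ‖E (x + y * I)‖ ≤ Emax)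
    (hleft : ∀ y : ℝ, y₀ ≤ y → y ≤ 1 → errAB t₀ X y + errC0 t₀ X y < (ft t₀ X y).re)
    (htop : ∀ x : ℝ, X ≤ x → errAB t₀ x 1 + errC0 t₀ x 1 < (ft t₀ x 1).re)
    (hright : ∀ x y : ℝ, X₁ ≤ x → y₀ ≤ y → y ≤ 1 →
      errAB t₀ x y + errC0 t₀ x y < (ft t₀ x y).re)
    (hbot : ∀ x : ℝ, X ≤ x → x ≤ X₁ → ∀ w : ℂ,
      ‖w - E (x + y₀ * I) * ft t₀ x y₀‖ ≤ Emax * (errAB t₀ x y₀ + errC0 t₀ x y₀) → w ∈ slitPlane) :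
    FinalZeroFree t₀ X y₀ :=
  finalZeroFree_of_mollified effective_approximation_holds ht₀ ht₀' hy₀ hy₀' hX hE hEre hEmax hleft
    htop hright hbot

/-! ## `Λ ≤ t₀ + y₀²/2` at certificate level, unconditional in Thm. 1.3 -/

/-- **`H_t` has only real zeros for `t > t₀ + y₀²/2` from a verified RH height, a winding certificate and a
tail inequality** (general parameters), unconditional in Thm. 1.3: `0 < t₀ ≤ 1/2`, `0 < y₀ < 1`, `X ≥ 200`,
`X/2 ≤ H`; RH up to height `H`; on the box `N` constant in `t` and `errAB + errC0 ≤ μ`; a winding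
certificate with margin `μ` for `f_t` on `[X, X+1] × [y₀, 1]` for every `t ∈ [0, t₀]`; and
`errAB + errC0 < |f_{t₀}(x + iy)|` for `x ≥ X`, `y₀ ≤ y ≤ 1`.
(= `upper_bound_of_certificates` fed with `effective_approximation_holds`.)
[cite: Polymath2019, Thm. 1.2, Cor. 1.4, §8.2–8.5] -/
theorem upper_bound_of_certificates' {t₀ X y₀ H μ : ℝ}
    (ht₀ : 0 < t₀) (ht₀' : t₀ ≤ 1 / 2) (hy₀ : 0 < y₀) (hy₀' : y₀ < 1) (hX : 200 ≤ X)
    (hH : X / 2 ≤ H) (hRH : DiophantineGeometry.RiemannHypothesisUpTo H)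
    (hN : ∀ t ∈ Icc 0 t₀, ∀ x ∈ Icc X (X + 1), rsN t x = rsN 0 x)
    (herr : ∀ t ∈ Ioc 0 t₀, ∀ x ∈ Icc X (X + 1), ∀ y ∈ Icc y₀ 1, errAB t x y + errC0 t x y ≤ μ)
    (hcert : ∀ t ∈ Icc 0 t₀, WindingCertGt (fz t) μ X (X + 1) y₀ 1)
    (htail : ∀ x y : ℝ, X ≤ x → y₀ ≤ y → y ≤ 1 → errAB t₀ x y + errC0 t₀ x y < ‖ft t₀ x y‖) :
    ∀ t : ℝ, t₀ + y₀ ^ 2 / 2 < t → HasOnlyRealZeros (deBruijnH t) :=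
  upper_bound_of_certificates effective_approximation_holds ht₀ ht₀' hy₀ hy₀' hX hH hRH hN herr hcert
    htail

/-- The `Λ`-form: `Λ ≤ t₀ + y₀²/2` from a verified RH height, a winding certificate and a tail inequality,
unconditional in Thm. 1.3. (= `deBruijnNewmanConst_le_of_certificates` fed with
`effective_approximation_holds`.) [cite: Polymath2019, Thm. 1.2, Cor. 1.4, §8.2–8.5] -/
theorem deBruijnNewmanConst_le_of_certificates' {t₀ X y₀ H μ : ℝ}
    (ht₀ : 0 < t₀) (ht₀' : t₀ ≤ 1 / 2) (hy₀ : 0 < y₀) (hy₀' : y₀ < 1) (hX : 200 ≤ X)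
    (hH : X / 2 ≤ H) (hRH : DiophantineGeometry.RiemannHypothesisUpTo H)
    (hN : ∀ t ∈ Icc 0 t₀, ∀ x ∈ Icc X (X + 1), rsN t x = rsN 0 x)
    (herr : ∀ t ∈ Ioc 0 t₀, ∀ x ∈ Icc X (X + 1), ∀ y ∈ Icc y₀ 1, errAB t x y + errC0 t x y ≤ μ)
    (hcert : ∀ t ∈ Icc 0 t₀, WindingCertGt (fz t) μ X (X + 1) y₀ 1)
    (htail : ∀ x y : ℝ, X ≤ x → y₀ ≤ y → y ≤ 1 → errAB t₀ x y + errC0 t₀ x y < ‖ft t₀ x y‖) :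
    deBruijnNewmanConst ≤ t₀ + y₀ ^ 2 / 2 :=
  deBruijnNewmanConst_le_of_certificates effective_approximation_holds ht₀ ht₀' hy₀ hy₀' hX hH hRH hN
    herr hcert htail

/-- **Certificate level at the Platt–Trudgian height**, unconditional in Thm. 1.3: given the named
computational fact `platt_trudgian_numerical_rh` (RH to height `3 000 175 332 800`, Platt–Trudgian 2021,
Thm. 1), for any `200 ≤ X` with `X/2 ≤ 3 000 175 332 800` a winding certificate for the box and the tail
inequality on the half-strip give `Λ ≤ t₀ + y₀²/2`.
(= `deBruijnNewmanConst_le_of_certificates_platt_trudgian` fed with `effective_approximation_holds`.)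
[cite: PlattTrudgianBLMS2021, Thm. 1 and §3.4] [cite: Polymath2019, Thm. 1.2, Cor. 1.4, §8.2–8.5] -/
theorem deBruijnNewmanConst_le_of_certificates_platt_trudgian'
    (h₁ : LFunctions.platt_trudgian_numerical_rh) {t₀ X y₀ μ : ℝ} (ht₀ : 0 < t₀) (ht₀' : t₀ ≤ 1 / 2)
    (hy₀ : 0 < y₀) (hy₀' : y₀ < 1) (hX : 200 ≤ X) (hH : X / 2 ≤ 3000175332800)
    (hN : ∀ t ∈ Icc 0 t₀, ∀ x ∈ Icc X (X + 1), rsN t x = rsN 0 x)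
    (herr : ∀ t ∈ Ioc 0 t₀, ∀ x ∈ Icc X (X + 1), ∀ y ∈ Icc y₀ 1, errAB t x y + errC0 t x y ≤ μ)
    (hcert : ∀ t ∈ Icc 0 t₀, WindingCertGt (fz t) μ X (X + 1) y₀ 1)
    (htail : ∀ x y : ℝ, X ≤ x → y₀ ≤ y → y ≤ 1 → errAB t₀ x y + errC0 t₀ x y < ‖ft t₀ x y‖) :
    deBruijnNewmanConst ≤ t₀ + y₀ ^ 2 / 2 :=
  deBruijnNewmanConst_le_of_certificates_platt_trudgian h₁ effective_approximation_holds ht₀ ht₀' hy₀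
    hy₀' hX hH hN herr hcert htail

/-- **Table 1, row 2 at certificate level, general height `H ≥ 2 500 000 097 429`**, unconditional in
Thm. 1.3: RH to height `H`, a winding certificate with margin `1/500` for the row-2 box and the row-2 tail
inequality on `x ≥ 5·10¹² + 194858`, `0.16733 ≤ y ≤ 1` give `Λ ≤ 1/5` — as printed, what Platt–Trudgian
2021, Cor. 2 takes from Polymath 15, §10 (row 2) plus the asymptotic half §10 describes as expected.
(= `deBruijnNewmanConst_le_one_fifth_of_row2_certificates` fed with `effective_approximation_holds`.)
[cite: Polymath2019, §10, Table 1 (row 2)] [cite: PlattTrudgianBLMS2021, §3.4 and Cor. 2] -/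
theorem deBruijnNewmanConst_le_one_fifth_of_row2_certificates' {H : ℝ}
    (hH : (2500000097429 : ℝ) ≤ H) (hRH : DiophantineGeometry.RiemannHypothesisUpTo H)
    (hcert : ∀ t ∈ Icc (0 : ℝ) 0.186, WindingCertGt (fz t) (1 / 500)
      (5 * 10 ^ 12 + 194858) (5 * 10 ^ 12 + 194858 + 1) 0.16733 1)
    (htail : ∀ x y : ℝ, (5 * 10 ^ 12 + 194858 : ℝ) ≤ x → (0.16733 : ℝ) ≤ y → y ≤ 1 →
      errAB 0.186 x y + errC0 0.186 x y < ‖ft 0.186 x y‖) :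
    deBruijnNewmanConst ≤ 1 / 5 :=
  deBruijnNewmanConst_le_one_fifth_of_row2_certificates effective_approximation_holds hH hRH hcert htail

end Polymath15

end Literature.NumberTheory.LFunctions

end
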